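import Summits.CriticalPhenomena.PercolationContinuityZ3.Theorems.PercNearOneGluingNoHeavyLowerTailKnQuestion8CoefficientwiseNoCoreBase
import HarnessLib

/-!
# The root-set stratification of CONJECTURE NO-CORE — prim-lf-2 gen 56

Support file (`--supports stmt-CriticalPhenomena-4575`, closed), prover `prim-lf-2` (gen 56).  No definitions, no named facts, no sorries; standard axioms.
Memo `prim-lf-2/CW-DELCON-gen56.md` §7–8.

Setting (as in `…CoefficientwiseNoCoreBase.lean`): multigraph `ends : ι → Sym2 V`, edge set `E`, root `x`, target `y`, colourings `s ⊆ E` (red) / `E ∖ s` (blue), `C_a(s) = openCluster (ends '' s) a`,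
summand `T(s) := (f(C_x s) − f(C_x(E∖s)))·(g(C_x s) − g(C_x(E∖s)))`.  For a vertex SET `S ∋ x` say that `y` is DOUBLY JOINED TO `S` in `s` if some vertex of `S` is red-joined to `y` and some
vertex of `S` is blue-joined to `y`, and put
  `N(S) := Σ_{s ⊆ E : y not doubly joined to S} T(s)`      (so `N({x})` is the NO-CORE sum; the constraint weakens as `S` grows).
* `Coefficientwise.noCore_of_strata` — **STRATIFICATION THEOREM (conditional).**  If every STRATUM is nonnegative,
  `M(S,q) := N(S) − N(S ∪ {q}) = Σ_{s : y doubly joined to S ∪ {q} but not to S} T(s) ≥ 0`   for all `S ∋ x` with `y ∉ S` and all `q ∉ S ∪ {y}`,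
  and the top of the chain `N(V ∖ {y}) ≥ 0`, then `0 ≤ N({x})`, i.e. CONJECTURE NO-CORE holds for `(E; x, y)` and the pair `(f, g)`: `N({x}) = Σ_i M(S_i, v_{i+1}) + N(V∖y)` along any chain.
  (prim-lf-2 gen 56, CONJECTURE M: every stratum is `≥ 0` for all monotone `f, g` — exact census over ALL monotone pairs on all graphs with ≤ 5 vertices (56 712 strata), W8', LOBE(3,3)(+leaf),
  K₃₃, Q₃: 0 negative; the top term is twice an instance of `offCluster_twoColouring_nonneg_gen_sub` with `A = ∅` (star of `y` monochromatic), and each stratum is a sum, over the frozen red or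
  blue cluster of `q`, of instances of the 'in-gadget' inequality (IG) of the memo — the single remaining atom.)
* `Coefficientwise.doublyJoined_mono` — the constraint is monotone in `S`.
[cite: KozmaNitzan2024, Questions 8–9 (§5.5 p. 36) (context: the Question-8 pocket covariance programme)]
-/

namespace Summit.CriticalPhenomena.PercolationContinuityZ3.Theorems

open Finset Literature.Probability.Percolation

namespace Coefficientwise

variable {ι V : Type*} [DecidableEq ι] [DecidableEq V]

omit [DecidableEq V] in
/-- Being doubly joined to a vertex set is monotone in the set. [cite: KozmaNitzan2024, §5.5 (context only; folklore)] -/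
theorem doublyJoined_mono (ends : ι → Sym2 V) (E : Finset ι) {S S' : Finset V} (hSS' : S ⊆ S') (y : V) (s : Finset ι)
    (h : (∃ a ∈ S, y ∈ openCluster (ends '' (↑s : Set ι)) a) ∧ (∃ a ∈ S, y ∈ openCluster (ends '' (↑(E \ s) : Set ι)) a)) :
    (∃ a ∈ S', y ∈ openCluster (ends '' (↑s : Set ι)) a) ∧ (∃ a ∈ S', y ∈ openCluster (ends '' (↑(E \ s) : Set ι)) a) := by
  obtain ⟨⟨a, ha, hay⟩, ⟨b, hb, hby⟩⟩ := h
  exact ⟨⟨a, hSS' ha, hay⟩, ⟨b, hSS' hb, hby⟩⟩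

open Classical in
/-- **STRATIFICATION THEOREM (conditional form of CONJECTURE NO-CORE).**  Let `V` be finite, `x ≠ y`.  If for every `S ∋ x` with `y ∉ S` and every `q ∉ S`, `q ≠ y`, the stratum
`Σ_{s ⊆ E : y doubly joined to insert q S, not to S} (f(C_x s) − f(C_x(E∖s)))(g(C_x s) − g(C_x(E∖s))) ≥ 0`, and the top term `Σ_{s : y not doubly joined to univ.erase y} (…) ≥ 0`,
then the NO-CORE sum `Σ_{s ⊆ E : ¬(y ∈ C_x s ∧ y ∈ C_x(E∖s))} (f(C_x s) − f(C_x(E∖s)))(g(C_x s) − g(C_x(E∖s)))` is `≥ 0`.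
[cite: KozmaNitzan2024, Questions 8–9 (§5.5 p. 36) (context)] -/
theorem noCore_of_strata [Fintype V] (ends : ι → Sym2 V) (E : Finset ι) (x y : V) (hyx : y ≠ x) (f g : Set V → ℝ)
    (hM : ∀ S : Finset V, x ∈ S → y ∉ S → ∀ q : V, q ∉ S → q ≠ y →
      0 ≤ ∑ s ∈ E.powerset.filter (fun s : Finset ι =>
          ¬ ((∃ a ∈ S, y ∈ openCluster (ends '' (↑s : Set ι)) a) ∧ (∃ a ∈ S, y ∈ openCluster (ends '' (↑(E \ s) : Set ι)) a)) ∧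
            ((∃ a ∈ insert q S, y ∈ openCluster (ends '' (↑s : Set ι)) a) ∧ (∃ a ∈ insert q S, y ∈ openCluster (ends '' (↑(E \ s) : Set ι)) a))),
        (f (openCluster (ends '' (↑s : Set ι)) x) - f (openCluster (ends '' (↑(E \ s) : Set ι)) x)) *
          (g (openCluster (ends '' (↑s : Set ι)) x) - g (openCluster (ends '' (↑(E \ s) : Set ι)) x)))
    (hTop : 0 ≤ ∑ s ∈ E.powerset.filter (fun s : Finset ι =>
          ¬ ((∃ a ∈ (Finset.univ : Finset V).erase y, y ∈ openCluster (ends '' (↑s : Set ι)) a) ∧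
             (∃ a ∈ (Finset.univ : Finset V).erase y, y ∈ openCluster (ends '' (↑(E \ s) : Set ι)) a))),
        (f (openCluster (ends '' (↑s : Set ι)) x) - f (openCluster (ends '' (↑(E \ s) : Set ι)) x)) *
          (g (openCluster (ends '' (↑s : Set ι)) x) - g (openCluster (ends '' (↑(E \ s) : Set ι)) x))) :
    0 ≤ ∑ s ∈ E.powerset.filter (fun s : Finset ι => ¬ (y ∈ openCluster (ends '' (↑s : Set ι)) x ∧
          y ∈ openCluster (ends '' (↑(E \ s) : Set ι)) x)),
      (f (openCluster (ends '' (↑s : Set ι)) x) - f (openCluster (ends '' (↑(E \ s) : Set ι)) x)) *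
        (g (openCluster (ends '' (↑s : Set ι)) x) - g (openCluster (ends '' (↑(E \ s) : Set ι)) x)) := by
  -- notation
  set K : Finset ι → Set V := fun s => openCluster (ends '' (↑s : Set ι)) x with hK
  set T : Finset ι → ℝ := fun s => (f (K s) - f (K (E \ s))) * (g (K s) - g (K (E \ s))) with hT
  set dbl : Finset V → Finset ι → Prop := fun S s =>
    (∃ a ∈ S, y ∈ openCluster (ends '' (↑s : Set ι)) a) ∧ (∃ a ∈ S, y ∈ openCluster (ends '' (↑(E \ s) : Set ι)) a) with hdbl
  have hM' : ∀ S : Finset V, x ∈ S → y ∉ S → ∀ q : V, q ∉ S → q ≠ y →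
      0 ≤ ∑ s ∈ E.powerset.filter (fun s => ¬ dbl S s ∧ dbl (insert q S) s), T s := hM
  have hTop' : 0 ≤ ∑ s ∈ E.powerset.filter (fun s => ¬ dbl ((Finset.univ : Finset V).erase y) s), T s := hTop
  change 0 ≤ ∑ s ∈ E.powerset.filter (fun s => ¬ (y ∈ K s ∧ y ∈ K (E \ s))), T s
  -- monotonicity of the constraint
  have hmono : ∀ {S S' : Finset V}, S ⊆ S' → ∀ s, dbl S s → dbl S' s := fun hSS' s h => doublyJoined_mono ends E hSS' y s h
  -- downward induction on the complement of `S`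
  have key : ∀ n : ℕ, ∀ S : Finset V, ((Finset.univ : Finset V) \ insert y S).card = n → x ∈ S → y ∉ S →
      0 ≤ ∑ s ∈ E.powerset.filter (fun s => ¬ dbl S s), T s := by
    intro n
    induction n with
    | zero =>
      intro S hcard hxS hyS
      have hS : S = (Finset.univ : Finset V).erase y := by
        ext v
        constructor
        · intro hv; exact Finset.mem_erase.mpr ⟨fun h => hyS (h ▸ hv), Finset.mem_univ v⟩
        · intro hv
          obtain ⟨hvy, _⟩ := Finset.mem_erase.mp hv
          by_contra hvS
          have : v ∈ (Finset.univ : Finset V) \ insert y S :=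
            Finset.mem_sdiff.mpr ⟨Finset.mem_univ v, fun h => by rcases Finset.mem_insert.mp h with h | h <;> [exact hvy h; exact hvS h]⟩
          rw [Finset.card_eq_zero.mp hcard] at this
          exact Finset.notMem_empty v this
      rw [hS]; exact hTop'
    | succ n ih =>
      intro S hcard hxS hyS
      -- pick a vertex `q` outside `insert y S`
      have hne : ((Finset.univ : Finset V) \ insert y S).Nonempty := by
        rw [← Finset.card_pos, hcard]; exact Nat.succ_pos n
      obtain ⟨q, hq⟩ := hne
      obtain ⟨_, hq'⟩ := Finset.mem_sdiff.mp hq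
      have hqy : q ≠ y := fun h => hq' (h ▸ Finset.mem_insert_self y S)
      have hqS : q ∉ S := fun h => hq' (Finset.mem_insert_of_mem h)
      -- split the constraint: ¬dbl S = (¬dbl S ∧ dbl (insert q S)) ⊔ ¬dbl (insert q S)
      have hsplit : ∑ s ∈ E.powerset.filter (fun s => ¬ dbl S s), T s =
          ∑ s ∈ E.powerset.filter (fun s => ¬ dbl S s ∧ dbl (insert q S) s), T s +
            ∑ s ∈ E.powerset.filter (fun s => ¬ dbl (insert q S) s), T s := by
        rw [← Finset.sum_filter_add_sum_filter_not (E.powerset.filter (fun s => ¬ dbl S s)) (fun s => dbl (insert q S) s) T,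
          Finset.filter_filter, Finset.filter_filter]
        congr 1
        refine Finset.sum_congr (Finset.filter_congr fun s _ => ?_) fun _ _ => rfl
        constructor
        · exact fun h => h.2
        · exact fun h => ⟨fun h' => h (hmono (Finset.subset_insert q S) s h'), h⟩
      rw [hsplit]
      refine add_nonneg (hM' S hxS hyS q hqS hqy) ?_
      refine ih (insert q S) ?_ (Finset.mem_insert_of_mem hxS) ?_
      · -- the complement loses the vertex `q`
        have : (Finset.univ : Finset V) \ insert y (insert q S) = ((Finset.univ : Finset V) \ insert y S).erase q := by
          ext v
          simp only [Finset.mem_sdiff, Finset.mem_univ, true_and, Finset.mem_insert, Finset.mem_erase, not_or]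
          tauto
        rw [this, Finset.card_erase_of_mem hq, hcard, Nat.add_sub_cancel]
      · intro h
        rcases Finset.mem_insert.mp h with h | h
        · exact hqy h.symm
        · exact hyS h
  -- apply with `S = {x}`
  have h0 := key _ {x} rfl (Finset.mem_singleton_self x) (fun h => hyx (Finset.mem_singleton.mp h))
  have hfilt : E.powerset.filter (fun s => ¬ dbl {x} s) = E.powerset.filter (fun s => ¬ (y ∈ K s ∧ y ∈ K (E \ s))) := by
    refine Finset.filter_congr fun s _ => ?_
    simp only [hdbl, Finset.mem_singleton, exists_eq_left, hK]
  rw [hfilt] at h0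
  exact h0

end Coefficientwise

end Summit.CriticalPhenomena.PercolationContinuityZ3.Theorems
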